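import Summits.QuantumFields.BalabanUV.T4Continuum.Spine.NE3.LeafIndex
import Summits.QuantumFields.BalabanUV.T4Continuum.Support.SmoothRefineOfApprox

/-!
# T⁴ programme, node NE3 — LEAF INDEX, part 2: the refinement SOCKETS of route (A), BY NAME

NE3 formalisation swarm, TYPER seat (unit `b2b-balaban-t4-ne3-formalise-typer`; DAG `t4/formal/NE3/DAG.md` v1.4, leaf table
`t4/formal/NE3/LEAVES.md` v1.3).  Part 1 (`Spine.NE3.LeafIndex`, p211209) indexed route (A) through
`MinimalActionRate.actionRate_sfClass` with the leaves (H1) ∕ (H3) ∕ (H2).  Since then the row-NE3 owner (lineage P1) re-cut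
leaf (H2) (DAG nodes A6–A11, all LANDED): `MinimalActionRefine.SmoothRefine` (the abelian road's target, crew row S4b) and
`SmoothRefineOfApprox.ApproxRefine` (SOCKET NE3-R1: the non-abelian road's target, crew row R1-ASM), together with the
sup-form leaves (H3ˢᵘᵖ) and (H0).  This module INDEXES those sockets BY NAME, exactly as part 1 did:

* `[shape]` definitions `LeafH3sup`, `LeafH0` (the literal hypothesis binders `h3`, `h0` of
  `MinimalActionRefine.actionRate_sfClass_of_smoothRefine` ∕ `SmoothRefineOfApprox.actionRate_sfClass_of_approxRefine`),
  `LeafR0` (= `SmoothRefine` on the small-field class) and `LeafR1` (= `ApproxRefine` on the small-field class) — each an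
  ABBREVIATION of a landed declaration applied to `sfClass`, never a restatement;
* `[bookkeeping]` one-line applications of LANDED theorems BY NAME: `leafH3_of_leafH3sup` (`RegularSup.regular`),
  `leafR0_of_leafR1` (`smoothRefine_of_approxRefine`), `rootA_sfClass_of_smoothRefine` (END-A′,
  `MinimalActionRefine.actionRate_sfClass_of_smoothRefine`) and `rootA_sfClass_of_approxRefine` (END-A″,
  `SmoothRefineOfApprox.actionRate_sfClass_of_approxRefine`), all concluding part 1's `RootA` — i.e.
  `T4EtaRateMin.ActionRate (minActReadings …) (wallConstNA d L · (g + b³)/L²) (L⁻²)` — with the constants the ENDs deliver.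

HONEST FRAMING.  Index ∕ bookkeeping only: no estimate of the cell, no new mathematics, no `def … : Prop` FACT, no
conditional (`BetaPertH`, (B), (B^μ)) used or hidden; nothing here bears on infinite volume, a mass gap, or the Clay
problem.  **NE3 is NOT proved**: `LeafH1` ∕ `LeafH3sup` ∕ `LeafH0` are B11 Thm 1 TYPE hypothesis shapes and `LeafR0` ∕
`LeafR1` are the crew's OPEN kinematic targets — every theorem below takes them as hypotheses.  NE3-(A) is CONDITIONAL on
⟨(H1), (H3ˢᵘᵖ), (H0), `ApproxRefine`⟩; spine estimates PROVED 0∕9; finite `T⁴` rung (B)+1 only.  ABSOLUTE RULE kept; no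
`sorry`, no axioms beyond Mathlib's.  PLACEMENT: `Summits/QuantumFields/BalabanUV/T4Continuum/Spine/NE3/`; imports the
LANDED modules `Spine.NE3.LeafIndex` (p211209) and `Support.SmoothRefineOfApprox` (p211841) only.
-/

set_option autoImplicit false

open scoped BigOperators Matrix Matrix.Norms.L2Operator
open NormedSpace

namespace Summit.QuantumFields.BalabanUV.T4Continuum.NE3.LeafIndexSockets

open Literature.MathematicalPhysics.QuantumFieldTheory.Balaban1983to89
open B7Prop1Explicit B7Prop2Explicit MatrixLog UnitaryModel
open T4AveragingDeficitWall hiding Site Plane Plaq Bond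
open T4AveragingDeficitWallBoundary (IsPeriodicCfg)
open T4AveragingDeficitNonAbelian (wallConstNA)
open T4EtaRateMin (Readings ActionRate)
open Summit.QuantumFields.BalabanUV.T4Continuum
open MinimalActionSandwich MinimalActionRate MinimalActionRefine ChainEndFix SmoothRefineOfApprox
open NE3.LeafIndex

noncomputable section

variable {d : ℕ} {n : Type*} [Fintype n] [DecidableEq n]

/-! ## §1 The sup-form Thm-1-TYPE leaves (H3ˢᵘᵖ) and (H0) — shapes -/

variable (d) in
/-- `[shape]` **LEAF (H3ˢᵘᵖ)** — sup-form regularity of the minimisers at every level `k+1` (B11 Thm 1 (8)+(9) TYPE in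
local gauges; crew row S3 via the gauge∕BCH dictionary): literally the binder `h3` of
`MinimalActionRefine.actionRate_sfClass_of_smoothRefine`.  A hypothesis SHAPE, asserted for no datum here. [folklore] -/
@[folklore]
def LeafH3sup (L N : ℕ) (ε b c : ℝ) (dom : Set (B7Prop1Explicit.Site d → Fin d → (Matrix n n ℂ)ˣ)) : Prop :=
  ∀ V ∈ dom, ∀ (k : ℕ) (U : B7Prop1Explicit.Site d → Fin d → (Matrix n n ℂ)ˣ),
    IsMinimiser d (sfClass d L N ε) L N (k + 1) V U → RegularSup d L N b c (k + 1) U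

variable (d) in
/-- `[shape]` **LEAF (H0)** — sup-form regularity of the data of `dom` at level `0` (crew row S7): literally the binder
`h0` of `MinimalActionRefine.actionRate_sfClass_of_smoothRefine`.  A hypothesis SHAPE. [folklore] -/
@[folklore]
def LeafH0 (L N : ℕ) (b c : ℝ) (dom : Set (B7Prop1Explicit.Site d → Fin d → (Matrix n n ℂ)ˣ)) : Prop :=
  ∀ V ∈ dom, RegularSup d L N b c 0 V

/-- `[bookkeeping]` (H3ˢᵘᵖ) implies part 1's `ℓ²` leaf (H3) with gradient constant `gradConst d c`
(`MinimalActionRefine.RegularSup.regular`, BY NAME). [folklore] -/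
theorem leafH3_of_leafH3sup {L N : ℕ} {ε b c : ℝ} {dom : Set (B7Prop1Explicit.Site d → Fin d → (Matrix n n ℂ)ˣ)}
    (h : LeafH3sup d L N ε b c dom) : LeafH3 d L N ε b (gradConst d c) dom :=
  fun V hV k U hU => (h V hV k U hU).regular

/-! ## §2 The refinement sockets R0 (`SmoothRefine`) and R1 (`ApproxRefine`) on the small-field class — shapes -/

variable (d) in
/-- `[shape]` **SOCKET R0** — the kinematic smooth-refinement shape ON THE SMALL-FIELD CLASS
(`MinimalActionRefine.SmoothRefine` BY NAME applied to `sfClass d L N ε`; the abelian road, crew row S4b, targets it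
directly).  OPEN; asserted for no parameters here. [folklore] -/
@[folklore]
def LeafR0 (L N : ℕ) (ε b c b' c' : ℝ) : Prop :=
  SmoothRefine d (sfClass (n := n) d L N ε) L N b c b' c'

variable (d) in
/-- `[shape]` **SOCKET R1 (SOCKET NE3-R1)** — the approximate covariant refinement shape ON THE SMALL-FIELD CLASS
(`SmoothRefineOfApprox.ApproxRefine` BY NAME applied to `sfClass d L N ε`; the non-abelian road's END, crew row R1-ASM,
targets it literally with `b₁ c₁ m` explicit in `(d, L, b, c)`).  OPEN; asserted for no parameters here. [folklore] -/
@[folklore]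
def LeafR1 (L N : ℕ) (ε b c b₁ c₁ m : ℝ) : Prop :=
  ApproxRefine d (sfClass (n := n) d L N ε) L N b c b₁ c₁ m

/-- `[bookkeeping]` `LeafR0` is literally `SmoothRefine` on the class. [folklore] -/
theorem leafR0_iff (L N : ℕ) (ε b c b' c' : ℝ) :
    LeafR0 (n := n) d L N ε b c b' c' ↔ SmoothRefine d (sfClass (n := n) d L N ε) L N b c b' c' :=
  Iff.rfl

/-- `[bookkeeping]` `LeafR1` is literally `ApproxRefine` on the class (SOCKET NE3-R1). [folklore] -/
theorem leafR1_iff (L N : ℕ) (ε b c b₁ c₁ m : ℝ) :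
    LeafR1 (n := n) d L N ε b c b₁ c₁ m ↔ ApproxRefine d (sfClass (n := n) d L N ε) L N b c b₁ c₁ m :=
  Iff.rfl

/-- `[bookkeeping]` **SOCKET R1 ⇒ SOCKET R0** — exactness of the block-average constraint is FREE
(`SmoothRefineOfApprox.smoothRefine_of_approxRefine`, BY NAME; `g = ChainEndFix.gap d L`). [folklore] -/
theorem leafR0_of_leafR1 [Nonempty n] {L N : ℕ} (hL : 1 ≤ L) {ε b c b₁ c₁ m : ℝ} (hb₁ : 0 ≤ b₁) (hm : 0 ≤ m)
    (hbs : 512 * (d + 1) * (d + 4) * (L : ℝ) ^ 2 * b₁ ≤ 1)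
    (hgap : 4 * (2 * (8 * (d + 1) * (d + 4) * (L : ℝ) ^ 2 * b₁) + 2 * m / gap d L) ≤ gap d L)
    (hhalf : b₁ + 8 * m / gap d L ≤ 1 / 2) (hε : b₁ + 8 * m * (L : ℝ) ^ 3 / gap d L ≤ ε)
    (hR1 : LeafR1 (n := n) d L N ε b c b₁ c₁ m) :
    LeafR0 (n := n) d L N ε b c (b₁ + 8 * m * (L : ℝ) ^ 3 / gap d L) (c₁ + 36 * m * (L : ℝ) ^ 3 / gap d L) :=
  smoothRefine_of_approxRefine hL hb₁ hm hbs hgap hhalf hε hR1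

/-! ## §3 ROOT-A from the sockets — END-A′ and END-A″ BY NAME -/

/-- `[bookkeeping]` **END-A′ indexed**: part 1's `RootA` (NE3's action half, `T4EtaRateMin.ActionRate` with rate `L⁻²`)
for the small-field class from (H1) + (H3ˢᵘᵖ) + (H0) + SOCKET R0, with constants `b ↦ max b b'`,
`g ↦ gradConst d (max c c')` — `MinimalActionRefine.actionRate_sfClass_of_smoothRefine` BY NAME.  NE3 is NOT proved:
every input is a hypothesis shape. [folklore] -/
theorem rootA_sfClass_of_smoothRefine [Nonempty n] {L N : ℕ} (hL : 1 ≤ L) (hN : 1 ≤ N) {b c b' c' ε : ℝ}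
    (hb : 0 ≤ b) (hBs : 512 * (d + 1) * (d + 4) * (L : ℝ) ^ 2 * max b b' ≤ 1)
    (hbε : b + 226 * (8 * (d + 1) * (d + 4)) ^ 2 * b ^ 2 ≤ ε)
    {dom : Set (B7Prop1Explicit.Site d → Fin d → (Matrix n n ℂ)ˣ)}
    (h1 : LeafH1 d L N ε dom) (h3 : LeafH3sup d L N ε b c dom) (h0 : LeafH0 d L N b c dom)
    (hR0 : LeafR0 (n := n) d L N ε b c b' c')
    {X : Type*} (loc : ℕ → (B7Prop1Explicit.Site d → Fin d → (Matrix n n ℂ)ˣ) → X → ℝ) :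
    RootA d (sfClass d L N ε) L N (max b b') (gradConst d (max c c')) dom loc :=
  actionRate_sfClass_of_smoothRefine hL hN hb hBs hbε h1 h3 h0 hR0 loc

/-- `[bookkeeping]` **END-A″ indexed**: part 1's `RootA` for the small-field class from (H1) + (H3ˢᵘᵖ) + (H0) +
SOCKET R1 (`ApproxRefine`, SOCKET NE3-R1), with constants `b ↦ max b (b₁ + 8mL³/g)`,
`g ↦ gradConst d (max c (c₁ + 36mL³/g))`, `g = ChainEndFix.gap d L` —
`SmoothRefineOfApprox.actionRate_sfClass_of_approxRefine` BY NAME.  NE3 is NOT proved: every input is a hypothesis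
shape; NE3-(A) is CONDITIONAL on ⟨(H1), (H3ˢᵘᵖ), (H0), `ApproxRefine`⟩. [folklore] -/
theorem rootA_sfClass_of_approxRefine [Nonempty n] {L N : ℕ} (hL : 1 ≤ L) (hN : 1 ≤ N) {b c b₁ c₁ m ε : ℝ}
    (hb : 0 ≤ b) (hb₁ : 0 ≤ b₁) (hm : 0 ≤ m)
    (hBs : 512 * (d + 1) * (d + 4) * (L : ℝ) ^ 2 * max b (b₁ + 8 * m * (L : ℝ) ^ 3 / gap d L) ≤ 1)
    (hbε : b + 226 * (8 * (d + 1) * (d + 4)) ^ 2 * b ^ 2 ≤ ε)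
    (hbs₁ : 512 * (d + 1) * (d + 4) * (L : ℝ) ^ 2 * b₁ ≤ 1)
    (hgap : 4 * (2 * (8 * (d + 1) * (d + 4) * (L : ℝ) ^ 2 * b₁) + 2 * m / gap d L) ≤ gap d L)
    (hhalf : b₁ + 8 * m / gap d L ≤ 1 / 2) (hε : b₁ + 8 * m * (L : ℝ) ^ 3 / gap d L ≤ ε)
    {dom : Set (B7Prop1Explicit.Site d → Fin d → (Matrix n n ℂ)ˣ)}
    (h1 : LeafH1 d L N ε dom) (h3 : LeafH3sup d L N ε b c dom) (h0 : LeafH0 d L N b c dom)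
    (hR1 : LeafR1 (n := n) d L N ε b c b₁ c₁ m)
    {X : Type*} (loc : ℕ → (B7Prop1Explicit.Site d → Fin d → (Matrix n n ℂ)ˣ) → X → ℝ) :
    RootA d (sfClass d L N ε) L N (max b (b₁ + 8 * m * (L : ℝ) ^ 3 / gap d L))
      (gradConst d (max c (c₁ + 36 * m * (L : ℝ) ^ 3 / gap d L))) dom loc :=
  actionRate_sfClass_of_approxRefine hL hN hb hb₁ hm hBs hbε hbs₁ hgap hhalf hε h1 h3 h0 hR1 loc

end

end Summit.QuantumFields.BalabanUV.T4Continuum.NE3.LeafIndexSockets
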